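import Literature.NumberTheory.LFunctions.NicolasCUpperExplicitRH
import Literature.NumberTheory.LFunctions.NicolasCTwoCriterion
import HarnessLib

/-!
# RH-CONDITIONAL — Nicolas 2012, Thm. 1.1 reduced to its printed finite table: the named fact `Nicolas2012_thm1_1` follows from the values `c(N_k)`, `k ≤ π(10⁹)`; nothing here bears on the truth of RH

RH-CONDITIONAL (the conclusion is the RH-conditional named fact `Nicolas2012_thm1_1`); nothing here
bears on the truth of RH. Literature-typing tranche 1 (Broughan, *Equivalents of the Riemann
Hypothesis* vol. 1, §5.7), from J.-L. Nicolas, Acta Arith. 155 (2012), 311–321, §4: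

  "we first consider `k₀ = 50847534`, the number of primes up to `x₀ = 10⁹`. For all `k ≤ k₀`, we
  have calculated `c(N_k)` in Maple … We have found that for `k₁ = 120568 < k ≤ k₀`,
  `c(N_k) < e^γ(2+β)` holds … and for `1 ≤ k ≤ k₀`, we have `c(N_1) = c(2) ≤ c(N_k) ≤ c(N_66)`.
  Further, for `k > k₀`, (3.2) implies `c(N_k) < e^γ(2+β) < c(N_66)` which, together with
  Lemma 3.1, proves (1.5) and (1.6)."

With (1.4) (`Nicolas2012_thm1_1_limsup`), (1.7) (`Nicolas2012_thm1_1_eq7`), Prop. 3.1 (3.2)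
(`nicolasC_primorial_lt_nicolasCLimsup_of_ge`) and Lemma 3.1 (`NicolasLimsup.nicolasC_le_of_primorial_le`,
`NicolasLimsup.exists_primorial_le_div_totient_le`) all theorems of the tree, this file proves that the
named fact `Nicolas2012_thm1_1` (`NicolasCriterion.lean`) follows from the TABLE alone
(`Nicolas2012_thm1_1_of_table`), the table entering as three hypotheses: `c(N_k) < e^γ(2+β)` for
`k₁ < k ≤ k₀`; `c(N_k) ≤ c(N_66)` for `k ≤ k₀`; and the two printed values
`e^γ(2+β) = 3.644… ≤ c(N_66) = 4.0628… ≤ 4.1`.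

Deviation from the printed proof (recorded): Lemma 3.1 needs `N_k/φ(N_k) ≤ e^γ(log log N_k + 2)`,
which Nicolas takes from Rosser–Schoenfeld's `n/φ(n) ≤ e^γ log log n + 2.51/log log n` ((1.1), not in
the tree); here it is read off the table itself: it is `c(N_k) ≤ 2e^γ √(log N_k)`, implied by
`c(N_k) ≤ 4.1` (`N_k ≥ 6`) and checked by hand at `N_1 = 2` (`hA_two`).

## References

* J.-L. Nicolas, *Small values of the Euler function and the Riemann hypothesis*, Acta Arith. 155
  (2012), 311–321, Thm. 1.1, Lemma 3.1, Prop. 3.1, §4. [Nicolas2012]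
* K. Broughan, *Equivalents of the Riemann Hypothesis*, vol. 1, CUP 2017, §5.7. [Broughan2017]
-/

noncomputable section

open Real
open scoped Chebyshev

namespace Literature.NumberTheory.LFunctions

namespace Nicolas2012Table

open NicolasChain NicolasLimsup

/-! ### Small lemmas on primorials -/

/-- `Π(m) ≤ Π(n)` for `m ≤ n` (each extra factor `q/(q−1) ≥ 1`). [folklore] -/
private theorem piRatio_mono {m n : ℕ} (h : m ≤ n) : piRatio m ≤ piRatio n := by
  unfold piRatio
  have hsub : Nat.primesLE m ⊆ Nat.primesLE n := by
    intro q hq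
    rw [Nat.mem_primesLE] at hq ⊢
    exact ⟨hq.1.trans h, hq.2⟩
  rw [← Finset.prod_sdiff hsub]
  have h1 : 1 ≤ ∏ q ∈ Nat.primesLE n \ Nat.primesLE m, ((q : ℝ) / ((q : ℝ) - 1)) := by
    refine Finset.prod_induction _ (fun x : ℝ => 1 ≤ x)
      (fun a b ha hb => one_le_mul_of_one_le_of_one_le ha hb) le_rfl fun q hq => ?_
    have hq2 : (2 : ℝ) ≤ q := by
      exact_mod_cast (Nat.prime_of_mem_primesLE (Finset.mem_sdiff.1 hq).1).two_le
    rw [le_div_iff₀ (by linarith)]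
    linarith
  have h0 : 0 ≤ ∏ q ∈ Nat.primesLE m, ((q : ℝ) / ((q : ℝ) - 1)) := by
    refine Finset.prod_nonneg fun q hq => ?_
    have hq2 : (2 : ℝ) ≤ q := by exact_mod_cast (Nat.prime_of_mem_primesLE hq).two_le
    exact div_nonneg (by linarith) (by linarith)
  exact le_mul_of_one_le_left h0 h1

/-- `m#/φ(m#) ≤ n#/φ(n#)` for `m ≤ n`. [folklore] -/
private theorem primorial_div_totient_mono {m n : ℕ} (h : m ≤ n) :
    (primorial m : ℝ) / (Nat.totient (primorial m) : ℝ) ≤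
      (primorial n : ℝ) / (Nat.totient (primorial n) : ℝ) := by
  rw [primorial_div_totient_eq_piRatio, primorial_div_totient_eq_piRatio]
  exact piRatio_mono h

/-- The largest prime `p ≤ Q` (`Q ≥ 2`) has `p# = Q#`. [folklore] -/
private theorem exists_prime_primorial_eq {Q : ℕ} (hQ : 2 ≤ Q) :
    ∃ p : ℕ, p.Prime ∧ p ≤ Q ∧ (∀ q : ℕ, q.Prime → q ≤ Q → q ≤ p) ∧ primorial p = primorial Q := by
  have hne : (Nat.primesLE Q).Nonempty := ⟨2, by rw [Nat.mem_primesLE]; exact ⟨hQ, Nat.prime_two⟩⟩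
  obtain ⟨p, hp⟩ : ∃ p, p = (Nat.primesLE Q).max' hne := ⟨_, rfl⟩
  have hpmem : p ∈ Nat.primesLE Q := hp ▸ Finset.max'_mem _ _
  rw [Nat.mem_primesLE] at hpmem
  have hmax : ∀ q : ℕ, q.Prime → q ≤ Q → q ≤ p := fun q hq hqQ ↦
    hp ▸ Finset.le_max' _ q (by rw [Nat.mem_primesLE]; exact ⟨hqQ, hq⟩)
  refine ⟨p, hpmem.2, hpmem.1, hmax, ?_⟩
  unfold primorial
  congr 1
  ext q
  simp only [Finset.mem_filter, Finset.mem_range]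
  constructor
  · rintro ⟨hq, hqp⟩
    exact ⟨by have := hpmem.1; omega, hqp⟩
  · rintro ⟨hq, hqp⟩
    exact ⟨Nat.lt_succ_of_le (hmax q hqp (by omega)), hqp⟩

/-- The `P` of Lemma 3.1 is `≥ 2` when `n ≥ 2` (`n/φ(n) > 1 = 1#/φ(1#)`). [folklore] -/
private theorem two_le_of_div_totient_le {n P : ℕ} (hn : 2 ≤ n)
    (hφ : (n : ℝ) / (Nat.totient n : ℝ) ≤ (primorial P : ℝ) / (Nat.totient (primorial P) : ℝ)) :
    2 ≤ P := by
  by_contra hP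
  push Not at hP
  have hP1 : primorial P = 1 := by
    interval_cases P
    · exact primorial_zero
    · exact primorial_one
  rw [hP1, Nat.totient_one] at hφ
  push_cast at hφ
  have hφn : (Nat.totient n : ℝ) < n := by exact_mod_cast Nat.totient_lt n (by omega)
  have hφ0 : (0 : ℝ) < Nat.totient n := by exact_mod_cast Nat.totient_pos.2 (by omega)
  rw [div_one, le_iff_lt_or_eq] at hφ
  rcases hφ with h | h
  · rw [div_lt_one hφ0] at h; linarith
  · rw [div_eq_one_iff_eq hφ0.ne'] at h; linarith

/-! ### Numerics -/

/-- `1.78107 ≤ e^γ < 1.7810726`. [folklore] -/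
private theorem exp_gamma_bounds :
    (1.78107 : ℝ) ≤ rexp eulerMascheroniConstant ∧ rexp eulerMascheroniConstant < 1.7810726 := by
  constructor
  · have hγ := Literature.Analysis.SpecialFunctions.Real.eulerMascheroniConstant_gt_d8
    have h1 : rexp 0.57721558 ≤ rexp eulerMascheroniConstant := Real.exp_le_exp.2 hγ.le
    have h2 := Real.sum_le_exp_of_nonneg (x := (0.57721558 : ℝ)) (by norm_num) 8
    have h3 : (1.78107 : ℝ) ≤ ∑ i ∈ Finset.range 8, (0.57721558 : ℝ) ^ i / (i.factorial : ℝ) := by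
      norm_num [Finset.sum_range_succ, Nat.factorial]
    linarith
  · have hγ := Literature.Analysis.SpecialFunctions.Real.eulerMascheroniConstant_lt_d8
    have h1 : rexp eulerMascheroniConstant < rexp 0.57721571 := Real.exp_lt_exp.2 hγ
    have h2 := Real.exp_bound' (x := (0.57721571 : ℝ)) (by norm_num) (by norm_num) (n := 10)
      (by norm_num)
    have h3 : (∑ m ∈ Finset.range 10, (0.57721571 : ℝ) ^ m / m.factorial) +
        (0.57721571 : ℝ) ^ 10 * (10 + 1) / (Nat.factorial 10 * 10) < 1.7810726 := by
      norm_num [Finset.sum_range_succ, Nat.factorial]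
    push_cast at h2
    linarith

/-- `e^γ(2+β) ≤ 3.65`. [folklore] -/
private theorem nicolasCLimsup_le : nicolasCLimsup ≤ 3.65 := by
  have h1 := exp_gamma_bounds.2
  have h2 := FordL33.nicolasBeta_lt_d5
  have h3 := nicolasBeta_gt
  have h0 := Real.exp_pos eulerMascheroniConstant
  unfold nicolasCLimsup
  nlinarith

/-- `4.1 ≤ 2 e^γ √(log N)` for `N ≥ 4` (`√(log 4) ≥ 1.1773`). [folklore] -/
private theorem two_exp_gamma_sqrt_log_ge {N : ℝ} (hN : 4 ≤ N) :
    (4.1 : ℝ) ≤ 2 * rexp eulerMascheroniConstant * Real.sqrt (Real.log N) := by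
  have hγ := exp_gamma_bounds.1
  have hl4 : (1.3862 : ℝ) ≤ Real.log N := by
    have h4 : Real.log 4 ≤ Real.log N := Real.log_le_log (by norm_num) hN
    rw [show (4 : ℝ) = 2 ^ 2 by norm_num, Real.log_pow] at h4
    have := Real.log_two_gt_d9
    push_cast at h4
    linarith
  have hs : (1.1773 : ℝ) ≤ Real.sqrt (Real.log N) := by
    calc (1.1773 : ℝ) = Real.sqrt (1.1773 ^ 2) := (Real.sqrt_sq (by norm_num)).symm
      _ ≤ Real.sqrt (Real.log N) := Real.sqrt_le_sqrt (by nlinarith)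
  nlinarith

/-- The monotonicity hypothesis of Lemma 3.1 at `N_1 = 2`: `2/φ(2) = 2 ≤ e^γ(log log 2 + 2)`
(`log log 2 ≥ −0.3666`). [cite: Nicolas2012, Lemma 3.1 (proof, "If `k = 1` or `2`, it is easy to see")] -/
private theorem hA_two : ((primorial 2 : ℕ) : ℝ) / (Nat.totient (primorial 2) : ℝ) ≤
    rexp eulerMascheroniConstant * (Real.log (Real.log ((primorial 2 : ℕ) : ℝ)) + 2) := by
  rw [primorial_two, Nat.totient_prime Nat.prime_two]
  push_cast
  have hγ := exp_gamma_bounds.1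
  have hl2 := Real.log_two_gt_d9
  have hl2' := Real.log_two_lt_d9
  have hl0 : 0 < Real.log 2 := by linarith
  have hll : -0.3666 ≤ Real.log (Real.log 2) := by
    rw [Real.le_log_iff_exp_le hl0]
    have h5 : (1.4428 : ℝ) ≤ Real.exp 0.3666 := by
      have h := Real.sum_le_exp_of_nonneg (x := (0.3666 : ℝ)) (by norm_num) 6
      have : (1.4428 : ℝ) ≤ ∑ i ∈ Finset.range 6, (0.3666 : ℝ) ^ i / (i.factorial : ℝ) := by
        norm_num [Finset.sum_range_succ, Nat.factorial]
      exact this.trans h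
    have hprod : 1 ≤ Real.exp 0.3666 * Real.log 2 := by nlinarith
    have e : Real.exp (-0.3666) = (Real.exp 0.3666)⁻¹ := by rw [← Real.exp_neg]
    rw [e, inv_le_iff_one_le_mul₀ (Real.exp_pos _)]
    linarith
  nlinarith

/-- **Lemma 3.1's hypothesis from the table**: if `c(P#) ≤ 4.1` and `P# ≥ 4` then
`P#/φ(P#) ≤ e^γ(log log P# + 2)` (it is `c(P#) ≤ 2e^γ √(log P#)`).
[cite: Nicolas2012, Lemma 3.1 (proof, the sign of `dh/dn`)] -/
private theorem hA_of_nicolasC_le {P : ℕ} (h4 : (4 : ℝ) ≤ (primorial P : ℝ))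
    (hc : nicolasC (primorial P) ≤ 4.1) :
    (primorial P : ℝ) / (Nat.totient (primorial P) : ℝ) ≤
      rexp eulerMascheroniConstant * (Real.log (Real.log (primorial P : ℝ)) + 2) := by
  have hge := two_exp_gamma_sqrt_log_ge h4
  have hl : 0 < Real.log (primorial P : ℝ) := Real.log_pos (by linarith)
  have hs : 0 < Real.sqrt (Real.log (primorial P : ℝ)) := Real.sqrt_pos.2 hl
  rw [nicolasC] at hc
  have h1 : ((primorial P : ℝ) / (Nat.totient (primorial P) : ℝ)
      - rexp eulerMascheroniConstant * Real.log (Real.log (primorial P : ℝ))) *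
        Real.sqrt (Real.log (primorial P : ℝ)) ≤
      (2 * rexp eulerMascheroniConstant) * Real.sqrt (Real.log (primorial P : ℝ)) := by linarith
  have h2 := le_of_mul_le_mul_right h1 hs
  linarith

/-- `6 ≤ P#` for `P ≥ 3`. [folklore] -/
private theorem six_le_primorial {P : ℕ} (hP : 3 ≤ P) : (6 : ℝ) ≤ (primorial P : ℝ) := by
  have h3 : primorial 3 = 6 := by decide
  exact_mod_cast h3 ▸ primorial_mono hP

/-- `1591883 = p_{120569}` is prime. [cite: Nicolas2012, Thm. 1.1 (1.5) (`N_{120569} = 2·3·…·1591883`)] -/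
private theorem prime_1591883 : Nat.Prime 1591883 := by norm_num

/-! ### The two clauses from the table -/

/-- **(1.6) from the table**: under RH, if `c(N_k) ≤ c(N_66)` for `p_k < 10⁹` and
`e^γ(2+β) ≤ c(N_66) ≤ 4.1`, then `c(n) ≤ c(N_66)` for every `n ≥ 2`.
[cite: Nicolas2012, §4 (proof of (1.6)) with Lemma 3.1 and Prop. 3.1 (3.2)] -/
theorem eq6_of_table (hRH : RiemannHypothesis)
    (hT6 : ∀ p : ℕ, p.Prime → (p : ℝ) < 10 ^ 9 → nicolasC (primorial p) ≤ nicolasC (primorial 317))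
    (h66 : nicolasCLimsup ≤ nicolasC (primorial 317) ∧ nicolasC (primorial 317) ≤ 4.1)
    {n : ℕ} (hn : 2 ≤ n) : nicolasC n ≤ nicolasC (primorial 317) := by
  obtain ⟨P, hPn, hφ⟩ := exists_primorial_le_div_totient_le (n := n) (by omega)
  have hP2 := two_le_of_div_totient_le hn hφ
  rcases Nat.lt_or_ge P 3 with hP3 | hP3
  · -- `P = 2`: `c(n) ≤ c(2) ≤ c(N_66)`
    have hP : P = 2 := by omega
    subst hP
    have h1 := nicolasC_le_of_primorial_le le_rfl hPn hφ hA_two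
    rw [primorial_two] at h1
    have h2 := hT6 2 Nat.prime_two (by norm_num)
    rw [primorial_two] at h2
    exact h1.trans h2
  · obtain ⟨p, hp, hpP, hmax, hpe⟩ := exists_prime_primorial_eq hP2
    have hp3 : 3 ≤ p := hmax 3 Nat.prime_three hP3
    -- the value `c(P#) = c(p#)`: from the table or from (3.2)
    have hval : nicolasC (primorial P) ≤ nicolasC (primorial 317) ∧ nicolasC (primorial P) ≤ 4.1 := by
      rw [← hpe]
      rcases lt_or_ge (p : ℝ) (10 ^ 9) with hlt | hge
      · exact ⟨hT6 p hp hlt, (hT6 p hp hlt).trans h66.2⟩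
      · have h := nicolasC_primorial_lt_nicolasCLimsup_of_ge hRH hge
        have hL := nicolasCLimsup_le
        exact ⟨(h.le.trans h66.1), by linarith⟩
    have hA := hA_of_nicolasC_le (by linarith [six_le_primorial hP3]) hval.2
    exact (nicolasC_le_of_primorial_le hP2 hPn hφ hA).trans hval.1

/-- **(1.5) from the table**: under RH, if `c(N_k) < e^γ(2+β)` for `1591883 ≤ p_k < 10⁹`, then
`c(n) < e^γ(2+β)` for every `n ≥ N_{120569} = 1591883#`.
[cite: Nicolas2012, §4 (proof of (1.5)) with Lemma 3.1 and Prop. 3.1 (3.2)] -/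
theorem eq5_of_table (hRH : RiemannHypothesis)
    (hT5 : ∀ p : ℕ, p.Prime → 1591883 ≤ p → (p : ℝ) < 10 ^ 9 → nicolasC (primorial p) < nicolasCLimsup)
    {n : ℕ} (hn : primorial 1591883 ≤ n) : nicolasC n < nicolasCLimsup := by
  have hK0 : 0 < primorial 1591883 := primorial_pos _
  obtain ⟨P, hPn, hφ⟩ := exists_primorial_le_div_totient_le (n := n) (by omega)
  -- `Q = max P 1591883`
  set Q : ℕ := max P 1591883 with hQ
  have hQK : 1591883 ≤ Q := le_max_right _ _
  have hQ2 : 2 ≤ Q := le_trans (by norm_num) hQK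
  have hQn : primorial Q ≤ n := by
    rcases le_total P 1591883 with h | h
    · rw [hQ, max_eq_right h]; exact hn
    · rw [hQ, max_eq_left h]; exact hPn
  have hφQ : (n : ℝ) / (Nat.totient n : ℝ) ≤ (primorial Q : ℝ) / (Nat.totient (primorial Q) : ℝ) :=
    hφ.trans (primorial_div_totient_mono (le_max_left _ _))
  obtain ⟨p, hp, hpQ, hmax, hpe⟩ := exists_prime_primorial_eq hQ2
  have hpK : 1591883 ≤ p := hmax _ prime_1591883 hQK
  -- the value `c(Q#) = c(p#) < e^γ(2+β)`
  have hval : nicolasC (primorial Q) < nicolasCLimsup := by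
    rw [← hpe]
    rcases lt_or_ge (p : ℝ) (10 ^ 9) with hlt | hge
    · exact hT5 p hp hpK hlt
    · exact nicolasC_primorial_lt_nicolasCLimsup_of_ge hRH hge
  have hA := hA_of_nicolasC_le (by linarith [six_le_primorial (le_trans (by norm_num) hQK)])
    (by linarith [nicolasCLimsup_le])
  exact (nicolasC_le_of_primorial_le hQ2 hQn hφQ hA).trans_lt hval

end Nicolas2012Table

open Nicolas2012Table

/-- **Nicolas 2012, Thm. 1.1 from its printed table.** The named fact `Nicolas2012_thm1_1`
((1.4)–(1.7) under RH) follows from Nicolas's computation of `c(N_k)` for `k ≤ k₀ = π(10⁹)` alone,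
entering as: `c(N_k) < e^γ(2+β)` for `k₁ = 120568 < k ≤ k₀` (i.e. `1591883 ≤ p_k < 10⁹`);
`c(N_k) ≤ c(N_66) = c(317#)` for `k ≤ k₀`; and the printed values `e^γ(2+β) = 3.6444… ≤ c(N_66) =
4.0628… ≤ 4.1`. Everything else ((1.4), (1.7), Lemma 3.1, Prop. 3.1 (3.2)) is a theorem of the tree.
[cite: Nicolas2012, Thm. 1.1 and §4] -/
theorem Nicolas2012_thm1_1_of_table
    (hT5 : ∀ p : ℕ, p.Prime → 1591883 ≤ p → (p : ℝ) < 10 ^ 9 → nicolasC (primorial p) < nicolasCLimsup)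
    (hT6 : ∀ p : ℕ, p.Prime → (p : ℝ) < 10 ^ 9 → nicolasC (primorial p) ≤ nicolasC (primorial 317))
    (h66 : nicolasCLimsup ≤ nicolasC (primorial 317) ∧ nicolasC (primorial 317) ≤ 4.1) :
    Nicolas2012_thm1_1 :=
  Nicolas2012_thm1_1_of_eq5_eq6 (fun hRH _ hn ↦ eq5_of_table hRH hT5 hn)
    (fun hRH _ hn ↦ eq6_of_table hRH hT6 h66 hn)

end Literature.NumberTheory.LFunctions

end
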